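import Summits.MatrixMultiplication.MatrixMultiplication.Theorems.ThresholdSubsetTriples.Negative.SymmetricAnsatz
import Summits.MatrixMultiplication.MatrixMultiplication.Theorems.SnSubsetDichotomyThresholdSubsetTriplesStubChainProductCard

/-!
# `ThresholdSubsetTriples` (crux stmt-MatrixMultiplication-10882, route `SnSubsetDichotomy`) —
# negative-side support VIII: line `triality-uniquely-cubing-translate` — what its design stub adds to `C⁺`,
# and the void twists (refuter cdisprove gen 2)

Definition-free copy of §8a of the crux workfile `Cruxes/ThresholdSubsetTriples/Disproof.lean` (v5); the line's
vocabulary (`UniquelyCubing`, `quotTranslate`, `TrialityThreshold`, the stub signature) is written as local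
notations, `chainProd` / `stub_chainProductCard` are the tree's (p88812).  About the skeleton
`Cruxes/ThresholdSubsetTriples/Lines/triality_uniquely_cubing_translate.lean` (open stub `stub_trialityChainDesign`):

* `stubWithoutFibres_iff_trialityThreshold`, `trialityThreshold_of_stub` — the design stub minus its fibre
  bound `|lvl⁻¹ j| ≤ 3` is EQUIVALENT to `C⁺ = TrialityThreshold` (`X` on `ℤ/3`-translate triples), so the
  stub is `C⁺` restricted to a host family (which contains every subgroup design): no cheap `stub_false`.
* `card_le_one_of_uniquelyCubing_one` — the twist `g = 1` is void (`|S| ≤ 1`), so at threshold `g³ = 1`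
  upgrades to `orderOf g = 3` (`exp_sqrt_le_sqrt_factorial`); `card_le_one_of_uniquelyCubing_of_conj_mem` —
  a `g`-conjugation-stable `S` is void: a triality design has no symmetry under its own twist;
  `uniquelyCubing_of_mul_subset` — hereditary twist conjugation: `r·B ⊆ S` makes `Q(B)·gʳ` uniquely cubing
  for the conjugate twist `gʳ = r⁻¹ g r` (the tail of a chain product is a design for every `gʳ`, `r ∈ R₀`).
(The factorial price of the twist's fixed points is `Negative.TwistFixedPoints`.)

Sources: Neumann 2011 Obs. 2.1 (translation ansatz); Cohn–Umans 2003 Def. 2.1; BCCGU 2017 (arXiv:1712.02302)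
§4; the line skeleton (planner, kernel-checked); folklore (Sims stabiliser chains).
-/

noncomputable section

set_option linter.dupNamespace false
set_option autoImplicit false

open scoped BigOperators Pointwise

namespace Summit.MatrixMultiplication.MatrixMultiplication.Theorems.ThresholdSubsetTriples.Negative

open Summit.MatrixMultiplication.MatrixMultiplication.Theses.SnSubsetDichotomy
open Summit.MatrixMultiplication.MatrixMultiplication.Theorems.ThresholdSubsetTriples
open Literature.Combinatorics.Additive

/-! ## §8a Line `triality-uniquely-cubing-translate` — what the design stub adds to `C⁺`; the void twists -/

section TrialityLine

variable {G : Type*} [Group G] [DecidableEq G]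

/-- `UniquelyCubing W g` of the line's skeleton, as a local notation (no new definition): `W` cubes to `1`
only as `g · g · g`. -/
local notation3 (prettyPrint := false) "UniquelyCubing[" W ", " g "]" =>
  ∀ w₁ ∈ (W : Finset _), ∀ w₂ ∈ W, ∀ w₃ ∈ W, w₁ * w₂ * w₃ = 1 → w₁ = g ∧ w₂ = g ∧ w₃ = g

/-- `quotTranslate S g = Q(S)·g` of the skeleton, as a local notation. -/
local notation3 (prettyPrint := false) "quotTranslate[" S ", " g "]" =>
  Finset.image (fun p => Prod.fst p * (Prod.snd p)⁻¹ * g) (S ×ˢ S)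

omit [DecidableEq G] in
/-- **The twist `g = 1` is void** (also any `g` for which `S` has two elements with `s s'⁻¹ g = g (s s'⁻¹)`,
the skeleton's `quot_comm_imp_eq`): `UniquelyCubing (Q(S)·1) 1` forces `|S| ≤ 1`, because
`(s s'⁻¹)(s' s⁻¹)(s s⁻¹) = 1`. -/
theorem card_le_one_of_uniquelyCubing_one [DecidableEq G] (S : Finset G)
    (h : UniquelyCubing[quotTranslate[S, (1 : G)], (1 : G)]) : S.card ≤ 1 := by
  rw [Finset.card_le_one]
  intro s hs s' hs'
  have hw : ∀ a ∈ S, ∀ b ∈ S, a * b⁻¹ * 1 ∈ quotTranslate[S, (1 : G)] :=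
    fun a ha b hb => Finset.mem_image.2 ⟨(a, b), Finset.mem_product.2 ⟨ha, hb⟩, rfl⟩
  have key := (h _ (hw s hs s' hs') _ (hw s' hs' s hs) _ (hw s hs s hs) (by group)).1
  have h1 : s * s'⁻¹ = 1 := by simpa using key
  exact mul_inv_eq_one.1 h1

/-- **No symmetry under the twist.**  If `S` is stable under conjugation by `g` (`g⁻¹ s g ∈ S` for
`s ∈ S`; e.g. a subgroup normalised by `g`, or a `g`-invariant chain class) and `Q(S)·g` is uniquely cubing,
then `|S| ≤ 1`: for `s ≠ s'` the triple `(s s'⁻¹ g) · (t t'⁻¹ g) · g` with `t = g⁻¹ s' g`, `t' = g⁻¹ s g`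
multiplies to `g³ = 1`.  So a triality design is never `g`-stable — in the line's PRIMARY sub-family
(levels = `g`-orbits, `S, S^g, S^{g²}` classes of one chain) the three classes must be genuinely distinct
direction systems. -/
theorem card_le_one_of_uniquelyCubing_of_conj_mem (S : Finset G) (g : G) (hg : g ^ 3 = 1)
    (hS : ∀ s ∈ S, g⁻¹ * s * g ∈ S) (hUC : UniquelyCubing[quotTranslate[S, g], g]) : S.card ≤ 1 := by
  have hg3 : g * g * g = 1 := by simpa [pow_succ, mul_assoc] using hg
  rw [Finset.card_le_one]
  intro s hs s' hs'
  have hw : ∀ a ∈ S, ∀ b ∈ S, a * b⁻¹ * g ∈ quotTranslate[S, g] :=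
    fun a ha b hb => Finset.mem_image.2 ⟨(a, b), Finset.mem_product.2 ⟨ha, hb⟩, rfl⟩
  have hgg : g ∈ quotTranslate[S, g] := by simpa using hw s hs s hs
  have hprod : (s * s'⁻¹ * g) * (g⁻¹ * s' * g * (g⁻¹ * s * g)⁻¹ * g) * g = 1 := by
    calc (s * s'⁻¹ * g) * (g⁻¹ * s' * g * (g⁻¹ * s * g)⁻¹ * g) * g = g * g * g := by group
      _ = 1 := hg3
  have key := (hUC _ (hw s hs s' hs') _ (hw _ (hS s' hs') _ (hS s hs)) _ hgg hprod).1
  have h1 : s * s'⁻¹ = 1 := mul_right_cancel (key.trans (one_mul g).symm)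
  exact mul_inv_eq_one.1 h1

/-- **Hereditary twist conjugation.**  If `Q(S)·g` is uniquely cubing and `r·B ⊆ S`, then `Q(B)·gʳ` is
uniquely cubing for the CONJUGATE twist `gʳ = r⁻¹ g r` (`Q(rB) = r Q(B) r⁻¹ ⊆ Q(S)` and conjugation is an
automorphism).  For a chain product `S = R₀·R₁⋯R_{k-1}` this says: the tail `R₁⋯R_{k-1}` is a triality design
for EVERY twist `gʳ`, `r ∈ R₀`, simultaneously (and so on down the chain) — in particular
`Q(R₁⋯R_{k-1}) ∩ C(gʳ) = 1` for all `r ∈ R₀` (`quot_comm_imp_eq`), a pruning rule for the line's search and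
the reason a large top level `R₀` taxes every lower level (lead census c2 §2, "cross-level tax"). -/
theorem uniquelyCubing_of_mul_subset (S B : Finset G) (g r : G)
    (hUC : UniquelyCubing[quotTranslate[S, g], g]) (hB : ∀ b ∈ B, r * b ∈ S) :
    UniquelyCubing[quotTranslate[B, r⁻¹ * g * r], r⁻¹ * g * r] := by
  intro w₁ hw₁ w₂ hw₂ w₃ hw₃ hprod
  obtain ⟨⟨b₁, b₁'⟩, hp₁, rfl⟩ := Finset.mem_image.1 hw₁
  obtain ⟨⟨b₂, b₂'⟩, hp₂, rfl⟩ := Finset.mem_image.1 hw₂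
  obtain ⟨⟨b₃, b₃'⟩, hp₃, rfl⟩ := Finset.mem_image.1 hw₃
  rw [Finset.mem_product] at hp₁ hp₂ hp₃
  have hw : ∀ a ∈ B, ∀ b ∈ B, (r * a) * (r * b)⁻¹ * g ∈ quotTranslate[S, g] :=
    fun a ha b hb => Finset.mem_image.2 ⟨(r * a, r * b), Finset.mem_product.2 ⟨hB a ha, hB b hb⟩, rfl⟩
  -- conjugating the relation by `r` gives a cubing triple of `Q(S)·g`
  have hrel : ((r * b₁) * (r * b₁')⁻¹ * g) * ((r * b₂) * (r * b₂')⁻¹ * g) *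
      ((r * b₃) * (r * b₃')⁻¹ * g) = 1 := by
    calc ((r * b₁) * (r * b₁')⁻¹ * g) * ((r * b₂) * (r * b₂')⁻¹ * g) * ((r * b₃) * (r * b₃')⁻¹ * g)
        = r * ((b₁ * b₁'⁻¹ * (r⁻¹ * g * r)) * (b₂ * b₂'⁻¹ * (r⁻¹ * g * r)) *
            (b₃ * b₃'⁻¹ * (r⁻¹ * g * r))) * r⁻¹ := by group
      _ = 1 := by rw [hprod]; group
  obtain ⟨h1, h2, h3⟩ := hUC _ (hw b₁ hp₁.1 b₁' hp₁.2) _ (hw b₂ hp₂.1 b₂' hp₂.2) _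
    (hw b₃ hp₃.1 b₃' hp₃.2) hrel
  have key : ∀ a b : G, (r * a) * (r * b)⁻¹ * g = g → a * b⁻¹ * (r⁻¹ * g * r) = r⁻¹ * g * r := by
    intro a b hab
    calc a * b⁻¹ * (r⁻¹ * g * r) = r⁻¹ * ((r * a) * (r * b)⁻¹ * g) * r := by group
      _ = r⁻¹ * g * r := by rw [hab]
  exact ⟨key _ _ h1, key _ _ h2, key _ _ h3⟩

/-- `C⁺ = TrialityThreshold` of the skeleton (local notation): cofinally in `n`, some `g` with `g³ = 1` and
ONE set `S` with `Q(S)·g` uniquely cubing and `|S| > √(n!)·e^{-c√n}`.  (`→ X` is the skeleton's proved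
`transfer_holds`; `X → ω(ℂ) = 2` is `Negative.matrixMultiplication_of_thresholdSubsetTriples`.) -/
local notation3 (prettyPrint := false) "TrialityThreshold!" =>
  ∀ c : ℝ, 0 < c → ∀ n₀ : ℕ, ∃ n ≥ n₀, ∃ g : Equiv.Perm (Fin n), g ^ 3 = 1 ∧
    ∃ S : Finset (Equiv.Perm (Fin n)), UniquelyCubing[quotTranslate[S, g], g] ∧
      Real.sqrt (n.factorial : ℝ) * Real.exp (-(c * Real.sqrt (n : ℝ))) < (S.card : ℝ)

/-- The registered stub `stub_trialityChainDesign` (verbatim signature, with the tree's `chainProd`; local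
notation). -/
local notation3 (prettyPrint := false) "StubTrialityChainDesign!" =>
  ∀ c : ℝ, 0 < c → ∀ n₀ : ℕ, ∃ n ≥ n₀, ∃ g : Equiv.Perm (Fin n), orderOf g = 3 ∧
    ∃ k : ℕ, ∃ lvl : Fin n → Fin k,
      (∀ j : Fin k, (Finset.univ.filter fun x => lvl x = j).card ≤ 3) ∧
      ∃ R : Fin k → Finset (Equiv.Perm (Fin n)),
        (∀ j : Fin k, ∀ r ∈ R j, ∀ x : Fin n, lvl x < j → r x = x) ∧
        (∀ j : Fin k, ∀ r ∈ R j, ∀ r' ∈ R j, (∀ x : Fin n, lvl x ≤ j → r' x = r x) → r = r') ∧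
        UniquelyCubing[quotTranslate[chainProd R, g], g] ∧
        Real.sqrt (n.factorial : ℝ) * Real.exp (-(c * Real.sqrt (n : ℝ))) <
          ((∏ j, (R j).card : ℕ) : ℝ)

/-- The stub with the FIBRE BOUND `|lvl⁻¹(j)| ≤ 3` dropped (everything else verbatim; local notation). -/
local notation3 (prettyPrint := false) "StubTrialityChainDesignWithoutFibres!" =>
  ∀ c : ℝ, 0 < c → ∀ n₀ : ℕ, ∃ n ≥ n₀, ∃ g : Equiv.Perm (Fin n), orderOf g = 3 ∧
    ∃ k : ℕ, ∃ lvl : Fin n → Fin k,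
      ∃ R : Fin k → Finset (Equiv.Perm (Fin n)),
        (∀ j : Fin k, ∀ r ∈ R j, ∀ x : Fin n, lvl x < j → r x = x) ∧
        (∀ j : Fin k, ∀ r ∈ R j, ∀ r' ∈ R j, (∀ x : Fin n, lvl x ≤ j → r' x = r x) → r = r') ∧
        UniquelyCubing[quotTranslate[chainProd R, g], g] ∧
        Real.sqrt (n.factorial : ℝ) * Real.exp (-(c * Real.sqrt (n : ℝ))) <
          ((∏ j, (R j).card : ℕ) : ℝ)

/-- Dropping a conjunct: the stub implies its fibre-free form. -/
theorem stubTrialityChainDesignWithoutFibres_of_stub (h : StubTrialityChainDesign!) :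
    StubTrialityChainDesignWithoutFibres! := by
  intro c hc n₀
  obtain ⟨n, hn, g, hg, k, lvl, -, R, hRK, hRT, hUC, hbig⟩ := h c hc n₀
  exact ⟨n, hn, g, hg, k, lvl, R, hRK, hRT, hUC, hbig⟩

/-- **Exact bookkeeping along the point chain** (the skeleton's glue, through the LANDED `stub_chainProductCard`,
p88812): level sets `R j ⊆ K_j = Fix{lvl < j}` that are partial transversals of `K_{j+1}` multiply
directly, `|R 0 ⋯ R (k-1)| = ∏ |R j|` — with NO use of the fibre bound. -/
theorem card_chainProd_eq {n k : ℕ} (lvl : Fin n → Fin k) (R : Fin k → Finset (Equiv.Perm (Fin n)))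
    (hRK : ∀ j : Fin k, ∀ r ∈ R j, ∀ x : Fin n, lvl x < j → r x = x)
    (hRT : ∀ j : Fin k, ∀ r ∈ R j, ∀ r' ∈ R j, (∀ x : Fin n, lvl x ≤ j → r' x = r x) → r = r') :
    (chainProd R).card = ∏ j, (R j).card := by
  let K : Fin (k + 1) → Subgroup (Equiv.Perm (Fin n)) := fun j =>
    fixingSubgroup (Equiv.Perm (Fin n)) {x : Fin n | ((lvl x : ℕ) : ℕ) < (j : ℕ)}
  have hK : Antitone K := by
    intro i j hij
    refine fixingSubgroup_antitone (Equiv.Perm (Fin n)) (Fin n) ?_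
    intro x hx
    simp only [Set.mem_setOf_eq] at hx ⊢
    exact lt_of_lt_of_le hx (Fin.le_def.1 hij)
  have hRK' : ∀ j : Fin k, ∀ r ∈ R j, r ∈ K j.castSucc := by
    intro j r hr
    rw [mem_fixingSubgroup_iff]
    intro y hy
    simp only [Set.mem_setOf_eq, Fin.val_castSucc] at hy
    rw [Equiv.Perm.smul_def]
    exact hRK j r hr y (Fin.lt_def.2 hy)
  have hRT' : ∀ j : Fin k, ∀ r ∈ R j, ∀ r' ∈ R j, r⁻¹ * r' ∈ K j.succ → r = r' := by
    intro j r hr r' hr' hmem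
    rw [mem_fixingSubgroup_iff] at hmem
    refine hRT j r hr r' hr' fun x hx => ?_
    have hx' : x ∈ {x : Fin n | ((lvl x : ℕ) : ℕ) < ((j.succ : Fin (k + 1)) : ℕ)} := by
      simp only [Set.mem_setOf_eq, Fin.val_succ]
      exact Nat.lt_succ_of_le (Fin.le_def.1 hx)
    have h1 := hmem x hx'
    rw [Equiv.Perm.smul_def, Equiv.Perm.mul_apply] at h1
    have h2 := congrArg r h1
    simpa using h2
  exact stub_chainProductCard (Equiv.Perm (Fin n)) k K R hK hRK' hRT'

/-- **Fibre-free stub `→ C⁺`.** -/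
theorem trialityThreshold_of_withoutFibres (h : StubTrialityChainDesignWithoutFibres!) :
    TrialityThreshold! := by
  intro c hc n₀
  obtain ⟨n, hn, g, hg, k, lvl, R, hRK, hRT, hUC, hbig⟩ := h c hc n₀
  refine ⟨n, hn, g, ?_, chainProd R, hUC, ?_⟩
  · rw [← hg]
    exact pow_orderOf_eq_one g
  · rw [card_chainProd_eq lvl R hRK hRT]
    exact hbig

/-- **`C⁺ →` fibre-free stub**: ONE level (`k = 1`, `lvl ≡ 0`, `R 0 = S`): the chain conditions are then
vacuous/automatic and `R 0 = S` is its own chain product.  (`g ≠ 1` because a threshold set has two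
elements for large `n` — `card_le_one_of_uniquelyCubing_one` + `exp_sqrt_le_sqrt_factorial` — so
`g³ = 1` upgrades to `orderOf g = 3`.) -/
theorem withoutFibres_of_trialityThreshold (h : TrialityThreshold!) :
    StubTrialityChainDesignWithoutFibres! := by
  intro c hc n₀
  obtain ⟨N, hN⟩ := exp_sqrt_le_sqrt_factorial hc.le
  obtain ⟨n, hn, g, hg3, S, hUC, hbig⟩ := h c hc (max n₀ N)
  have hn₀ : n₀ ≤ n := (le_max_left _ _).trans hn
  have hnN : N ≤ n := (le_max_right _ _).trans hn
  -- `|S| ≥ 2`, hence `g ≠ 1`, hence `orderOf g = 3`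
  have hS2 : 1 < S.card := by
    have he : Real.exp (c * Real.sqrt n) * Real.exp (-(c * Real.sqrt n)) = 1 := by
      rw [← Real.exp_add, add_neg_cancel, Real.exp_zero]
    have h1 : (1 : ℝ) ≤ Real.sqrt (n.factorial : ℝ) * Real.exp (-(c * Real.sqrt (n : ℝ))) := by
      calc (1 : ℝ) = Real.exp (c * Real.sqrt n) * Real.exp (-(c * Real.sqrt n)) := he.symm
        _ ≤ Real.sqrt (n.factorial : ℝ) * Real.exp (-(c * Real.sqrt (n : ℝ))) :=
            mul_le_mul_of_nonneg_right (hN n hnN) (Real.exp_pos _).le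
    have h2 : (1 : ℝ) < S.card := lt_of_le_of_lt h1 hbig
    exact_mod_cast h2
  have hg1 : g ≠ 1 := by
    rintro rfl
    have := card_le_one_of_uniquelyCubing_one S hUC
    omega
  have hord : orderOf g = 3 :=
    orderOf_eq_prime hg3 hg1
  refine ⟨n, hn₀, g, hord, 1, fun _ => 0, fun _ => S, ?_, ?_, ?_, ?_⟩
  · intro j r _ x hx
    exact absurd hx (by simp)
  · intro j r _ r' _ hagree
    exact Equiv.ext fun x => (hagree x (by simp)).symm
  · have hcp : chainProd (fun _ : Fin 1 => S) = S := by
      rw [chainProd_succ, chainProd_zero, mul_one]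
    rw [hcp]
    exact hUC
  · simpa using hbig

/-- **What the design stub adds to `C⁺`.**  The fibre-free stub is EQUIVALENT to `C⁺ = TrialityThreshold`;
so the fibre bound `|lvl⁻¹(j)| ≤ 3` (≥ n/3 genuine chain steps) is the line's only content beyond `C⁺`, and
the skeleton's glue `ThresholdSubsetTriples_of` (which discards that hypothesis) is `C⁺ → X` in costume.
`C⁺` is `X` on `ℤ/3`-translate triples — the symmetric half of BCCGU 2017 §4's open question — so no
`_false_without_fibres` theorem is available: the fibre bound is load-bearing only relative to an open
statement. -/
theorem stubWithoutFibres_iff_trialityThreshold :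
    StubTrialityChainDesignWithoutFibres! ↔ TrialityThreshold! :=
  ⟨trialityThreshold_of_withoutFibres, withoutFibres_of_trialityThreshold⟩

/-- The registered stub implies `C⁺`. -/
theorem trialityThreshold_of_stub (h : StubTrialityChainDesign!) : TrialityThreshold! :=
  trialityThreshold_of_withoutFibres (stubTrialityChainDesignWithoutFibres_of_stub h)


end TrialityLine


end Summit.MatrixMultiplication.MatrixMultiplication.Theorems.ThresholdSubsetTriples.Negative

end
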